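import Summits.KontsevichZagierPeriods.KontsevichZagierPeriods.Theorems.FurushoPentagonPentagonInKZCornerReps
import Summits.KontsevichZagierPeriods.KontsevichZagierPeriods.Theorems.FurushoPentagonPentagonInKZSimplexToCube
import Literature.NumberTheory.Transcendental.KZDominatedFamilyRelations
import Literature.NumberTheory.Transcendental.NashCubes
import Literature.NumberTheory.Transcendental.SemialgebraicLineDeriv

/-!
# `PentagonInKZ`, line `edge-normal-newton-leibniz`: corner engine — classes of cube representations up to null sets

Bookkeeping for the proof of `cornerEngine_uniformlyNull` (crux `FurushoPentagon.PentagonInKZ`,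
stmt-KontsevichZagierPeriods-11348), continuing `…CornerReps.lean`.  All representations of the
engine live on closed unit cubes `KZ.cube d`; the pointwise identities between their integrands
hold on the OPEN cube `openUnitCube d` only (the regularised letters carry total inverses
`1 / xᵢ`), which differs from the closed cube by a null set.  This file provides the
corresponding calculus of classes `⟦r⟧ = toPeriodAlgebra (toFormalPeriod [r]) ∈ P_ℚ`:

* `exists_rep_cube_of_bound` — a `ℚ`-semialgebraic function on `[0,1]ᵈ` bounded on `(0,1)ᵈ` is the
  integrand of a representation with domain the cube;
* `cls_congr_open`, `cls_eq_zero_open`, `cls_finset_sum_open`, `cls_sub_open` — congruence,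
  vanishing and (finite) integrand additivity for integrands compared on the open cube;
* `cls_newtonLeibniz_open` — rule (3) along the last coordinate, hypotheses required over the
  open base cube only;

(The coordinate permutations of the engine are in `…CornerBlocks.lean`.)

References: [KontsevichZagier2001, §1.2 rules (1)–(3)].
-/

noncomputable section

open Set MeasureTheory
open Literature.NumberTheory.Transcendental
open Literature.ModelTheory.ExponentialFields (IsSemialgebraic)

namespace Summit.KontsevichZagierPeriods.FurushoPentagon.PentagonInKZ

namespace CornerCubes

variable {d : ℕ}

/-! ### The open cube inside the closed cube -/

/-- `(0,1)ᵈ ⊆ [0,1]ᵈ` (`KZ.cube` form). [folklore] -/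
theorem openUnitCube_subset_cube : openUnitCube d ⊆ KZ.cube d := fun _ hz =>
  KZ.mem_cube.2 fun i => ⟨(hz i).1.le, (hz i).2.le⟩

/-- Almost every point of the closed cube lies in the open cube. [folklore] -/
theorem ae_mem_openUnitCube :
    ∀ᵐ z ∂(volume.restrict (KZ.cube d)), z ∈ openUnitCube d := by
  rw [ae_restrict_iff' KZ.measurableSet_cube]
  have h0 := SimplexToCube.volume_cube_diff_openUnitCube d
  rw [measure_eq_zero_iff_ae_notMem] at h0
  filter_upwards [h0] with z hz hzc
  by_contra h
  exact hz ⟨hzc, h⟩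

/-! ### Representations on the cube -/

/-- **A semialgebraic function on the closed unit cube bounded on the open cube is the integrand
of a representation** (domain the cube): a.e.-strongly measurable and a.e. bounded on a set of
measure `1`. [cite: KontsevichZagier2001, §1.1] -/
theorem exists_rep_cube_of_bound (g : (Fin d → ℝ) → ℝ) (hg : IsSemialgebraicFunOn ℚ (KZ.cube d) g)
    (hb : ∃ C : ℝ, ∀ z ∈ openUnitCube d, |g z| ≤ C) :
    ∃ r : KZ.IntegralRep d, r.domain = KZ.cube d ∧ r.integrand = g := by
  obtain ⟨C, hC⟩ := hb
  refine ⟨⟨KZ.cube d, g, KZ.isSemialgebraic_cube, hg, ?_⟩, rfl, rfl⟩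
  have hvol : volume (KZ.cube d) ≠ ⊤ := by
    rw [KZ.cube_eq_Icc]; exact measure_Icc_lt_top.ne
  refine ⟨KZ.aestronglyMeasurable_of_isSemialgebraicFunOn hg KZ.measurableSet_cube,
    HasFiniteIntegral.restrict_of_bounded (C := C) hvol.lt_top ?_⟩
  filter_upwards [ae_mem_openUnitCube] with z hz
  rw [Real.norm_eq_abs]; exact hC z hz

/-! ### Classes up to null sets -/

/-- **Congruence off a null set**: two representations on the cube whose integrands agree on the
open cube have the same class (domain additivity with the null boundary, rule (1)).
[cite: KontsevichZagier2001, §1.2 rule (1)] -/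
theorem cls_congr_open {r r' : KZ.IntegralRep d} (hr : r.domain = KZ.cube d)
    (hr' : r'.domain = KZ.cube d) (h : ∀ z ∈ openUnitCube d, r.integrand z = r'.integrand z) :
    KZ.toPeriodAlgebra (KZ.toFormalPeriod (KZ.of r)) = KZ.toPeriodAlgebra (KZ.toFormalPeriod (KZ.of r')) := by
  have hE : IsSemialgebraic ℚ (openUnitCube d) := isSemialgebraic_openUnitCube
  have hEr : openUnitCube d ⊆ r.domain := hr ▸ openUnitCube_subset_cube
  have hEr' : openUnitCube d ⊆ r'.domain := hr' ▸ openUnitCube_subset_cube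
  have h₁ := r.of_sub_of_restrict_mem_relations hE hEr
    (by rw [hr]; exact SimplexToCube.volume_cube_diff_openUnitCube d)
  have h₂ := r'.of_sub_of_restrict_mem_relations hE hEr'
    (by rw [hr']; exact SimplexToCube.volume_cube_diff_openUnitCube d)
  have h₃ : KZ.of (r.restrict (openUnitCube d) hE hEr) - KZ.of (r'.restrict (openUnitCube d) hE hEr') ∈
      KZ.relations :=
    KZ.of_sub_of_mem_relations_of_eqOn rfl fun z hz => h z hz
  have : KZ.of r - KZ.of r' = (KZ.of r - KZ.of (r.restrict _ hE hEr)) -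
      (KZ.of r' - KZ.of (r'.restrict _ hE hEr')) +
      (KZ.of (r.restrict _ hE hEr) - KZ.of (r'.restrict _ hE hEr')) := by abel
  have hrel : KZ.of r - KZ.of r' ∈ KZ.relations := by
    rw [this]; exact KZ.relations.add_mem (KZ.relations.sub_mem h₁ h₂) h₃
  have h0 := KZ.toFormalPeriod_eq_zero_of_mem hrel
  rw [map_sub, sub_eq_zero] at h0
  rw [h0]

/-- A representation on the cube whose integrand vanishes on the open cube has class `0`.
[cite: KontsevichZagier2001, §1.2 rule (1)] -/
theorem cls_eq_zero_open {r : KZ.IntegralRep d} (hr : r.domain = KZ.cube d)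
    (h : ∀ z ∈ openUnitCube d, r.integrand z = 0) :
    KZ.toPeriodAlgebra (KZ.toFormalPeriod (KZ.of r)) = 0 := by
  obtain ⟨r₀, hr₀, hr₀i⟩ := exists_rep_cube_of_bound (d := d) (fun _ => 0)
    ((isSemialgebraicFunOn_aeval KZ.isSemialgebraic_cube (0 : MvPolynomial (Fin d) ℚ)).congr
      fun y _ => by simp) ⟨0, fun z _ => by simp⟩
  rw [cls_congr_open hr hr₀ (fun z hz => by rw [h z hz, hr₀i])]
  exact CornerReps.cls_eq_zero_of_eqOn_zero r₀ fun z _ => by rw [hr₀i]; rfl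

/-- **Finite integrand additivity** (exact form): if the integrand of `r` is the sum of the
integrands of the `ρ i` on the common domain, then `⟦r⟧ = Σᵢ ⟦ρ i⟧`.
[cite: KontsevichZagier2001, §1.2 rule (1)] -/
theorem cls_finset_sum {ι : Type*} (s : Finset ι) :
    ∀ (r : KZ.IntegralRep d) (ρ : ι → KZ.IntegralRep d), (∀ i ∈ s, (ρ i).domain = r.domain) →
      EqOn r.integrand (fun z => ∑ i ∈ s, (ρ i).integrand z) r.domain →
      KZ.toPeriodAlgebra (KZ.toFormalPeriod (KZ.of r)) =
        ∑ i ∈ s, KZ.toPeriodAlgebra (KZ.toFormalPeriod (KZ.of (ρ i))) := by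
  classical
  induction s using Finset.induction_on with
  | empty =>
    intro r ρ _ h
    rw [Finset.sum_empty]
    exact CornerReps.cls_eq_zero_of_eqOn_zero r fun z hz => by simpa using h hz
  | insert a s ha ih =>
    intro r ρ hd h
    -- the partial sum over `s` as a representation on `r.domain`
    let r'' : KZ.IntegralRep d :=
      ⟨r.domain, fun z => ∑ i ∈ s, (ρ i).integrand z, r.isSemialgebraic_domain,
        IsSemialgebraicFunOn.fun_finsetSum s r.isSemialgebraic_domain fun i hi => by
          rw [← hd i (Finset.mem_insert_of_mem hi)]; exact (ρ i).isSemialgebraicFunOn_integrand,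
        integrable_finsetSum s fun i hi => by
          rw [← hd i (Finset.mem_insert_of_mem hi)]; exact (ρ i).integrableOn⟩
    have hadd : EqOn r.integrand ((ρ a).integrand + r''.integrand) r.domain := fun z hz => by
      rw [h hz]
      simp only [Finset.sum_insert ha, Pi.add_apply]
      rfl
    rw [CornerReps.cls_add (r₂ := r'') (hd a (Finset.mem_insert_self a s)) rfl hadd, Finset.sum_insert ha,
      ih r'' ρ (fun i hi => hd i (Finset.mem_insert_of_mem hi)) (fun z _ => rfl)]

/-- **Finite integrand additivity off a null set**: representations on the cube, the integrand of
`r` being the sum of those of the `ρ i` on the open cube. [cite: KontsevichZagier2001, §1.2 rule (1)] -/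
theorem cls_finset_sum_open {ι : Type*} (s : Finset ι) (r : KZ.IntegralRep d)
    (ρ : ι → KZ.IntegralRep d) (hr : r.domain = KZ.cube d) (hρ : ∀ i ∈ s, (ρ i).domain = KZ.cube d)
    (h : ∀ z ∈ openUnitCube d, r.integrand z = ∑ i ∈ s, (ρ i).integrand z) :
    KZ.toPeriodAlgebra (KZ.toFormalPeriod (KZ.of r)) =
      ∑ i ∈ s, KZ.toPeriodAlgebra (KZ.toFormalPeriod (KZ.of (ρ i))) := by
  -- the sum as an (exact) representation on the cube
  let r'' : KZ.IntegralRep d :=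
    ⟨KZ.cube d, fun z => ∑ i ∈ s, (ρ i).integrand z, KZ.isSemialgebraic_cube,
      IsSemialgebraicFunOn.fun_finsetSum s KZ.isSemialgebraic_cube fun i hi => by
        rw [← hρ i hi]; exact (ρ i).isSemialgebraicFunOn_integrand,
      integrable_finsetSum s fun i hi => by rw [← hρ i hi]; exact (ρ i).integrableOn⟩
  rw [cls_congr_open (r' := r'') hr rfl h]
  exact cls_finset_sum s r'' ρ (fun i hi => hρ i hi) fun z _ => rfl

/-- **Integrand additivity off a null set, difference form.** [cite: KontsevichZagier2001, §1.2 rule (1)] -/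
theorem cls_sub_open {r r₁ r₂ : KZ.IntegralRep d} (hr : r.domain = KZ.cube d)
    (h₁ : r₁.domain = KZ.cube d) (h₂ : r₂.domain = KZ.cube d)
    (h : ∀ z ∈ openUnitCube d, r.integrand z = r₁.integrand z - r₂.integrand z) :
    KZ.toPeriodAlgebra (KZ.toFormalPeriod (KZ.of r)) =
      KZ.toPeriodAlgebra (KZ.toFormalPeriod (KZ.of r₁)) - KZ.toPeriodAlgebra (KZ.toFormalPeriod (KZ.of r₂)) := by
  -- `r₁ = r + r₂` on the open cube
  have := cls_finset_sum_open (ι := Bool) Finset.univ r₁ (fun b => if b then r else r₂) h₁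
    (fun b _ => by cases b <;> simp [hr, h₂]) fun z hz => by
      rw [Fintype.sum_bool]
      simp only [ite_true, Bool.false_eq_true, ite_false, h z hz, sub_add_cancel]
  rw [Fintype.sum_bool] at this
  simp only [ite_true, Bool.false_eq_true, ite_false] at this
  rw [this, add_sub_cancel_right]

/-- **Integrand additivity off a null set, sum form.** [cite: KontsevichZagier2001, §1.2 rule (1)] -/
theorem cls_add_open {r r₁ r₂ : KZ.IntegralRep d} (hr : r.domain = KZ.cube d)
    (h₁ : r₁.domain = KZ.cube d) (h₂ : r₂.domain = KZ.cube d)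
    (h : ∀ z ∈ openUnitCube d, r.integrand z = r₁.integrand z + r₂.integrand z) :
    KZ.toPeriodAlgebra (KZ.toFormalPeriod (KZ.of r)) =
      KZ.toPeriodAlgebra (KZ.toFormalPeriod (KZ.of r₁)) + KZ.toPeriodAlgebra (KZ.toFormalPeriod (KZ.of r₂)) := by
  have := cls_finset_sum_open (ι := Bool) Finset.univ r (fun b => if b then r₁ else r₂) hr
    (fun b _ => by cases b <;> simp [h₁, h₂]) fun z hz => by
      rw [Fintype.sum_bool]
      simp only [ite_true, Bool.false_eq_true, ite_false, h z hz]
  rw [Fintype.sum_bool] at this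
  simpa only [ite_true, Bool.false_eq_true, ite_false] using this

/-! ### Newton–Leibniz with hypotheses over the open base cube -/

/-- Points `Fin.snoc x t` with `x` in the open cube and `t ∈ (0,1)` exhaust the open cube.
[folklore] -/
theorem snoc_mem_openUnitCube_iff {x : Fin d → ℝ} {t : ℝ} :
    (Fin.snoc x t : Fin (d + 1) → ℝ) ∈ openUnitCube (d + 1) ↔ x ∈ openUnitCube d ∧ t ∈ Ioo (0 : ℝ) 1 := by
  simp only [mem_openUnitCube_iff, Fin.forall_fin_succ', Fin.snoc_castSucc, Fin.snoc_last]

/-- **Newton–Leibniz along the last coordinate of the cube, a.e. form**: as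
`CornerReps.cls_newtonLeibniz_cube`, but continuity, differentiability and the evaluation of the
primitive are only required over base points of the OPEN cube (the primitive, the band integrand
and the base integrand are replaced by `0` over the null complement).
[cite: KontsevichZagier2001, §1.2 rule (3)] -/
theorem cls_newtonLeibniz_open (r : KZ.IntegralRep (d + 1)) (r' : KZ.IntegralRep d)
    (G : (Fin (d + 1) → ℝ) → ℝ) (hr : r.domain = KZ.cube (d + 1)) (hr' : r'.domain = KZ.cube d)
    (hG : IsSemialgebraicFunOn ℚ (KZ.cube (d + 1)) G)
    (hcont : ∀ x ∈ openUnitCube d, ContinuousOn (fun t : ℝ => G (Fin.snoc x t)) (Icc 0 1))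
    (hderiv : ∀ x ∈ openUnitCube d, ∀ t ∈ Ioo (0 : ℝ) 1,
      HasDerivAt (fun s : ℝ => G (Fin.snoc x s)) (r.integrand (Fin.snoc x t)) t)
    (hbase : ∀ x ∈ openUnitCube d, r'.integrand x = G (Fin.snoc x 1) - G (Fin.snoc x 0)) :
    KZ.toPeriodAlgebra (KZ.toFormalPeriod (KZ.of r)) = KZ.toPeriodAlgebra (KZ.toFormalPeriod (KZ.of r')) := by
  classical
  -- the guard: base point in the open cube
  let A : Set (Fin (d + 1) → ℝ) := {z | Fin.init z ∈ openUnitCube d}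
  have hA : IsSemialgebraic ℚ A := by
    have : A = ⋂ i ∈ (Finset.univ : Finset (Fin d)),
        ({z : Fin (d + 1) → ℝ | 0 < MvPolynomial.aeval z (MvPolynomial.X (Fin.castSucc i) : MvPolynomial (Fin (d + 1)) ℚ)} ∩
          {z | 0 < MvPolynomial.aeval z (1 - MvPolynomial.X (Fin.castSucc i) : MvPolynomial (Fin (d + 1)) ℚ)}) := by
      ext z
      simp [A, mem_openUnitCube_iff, Fin.init, sub_pos]
    rw [this]
    exact IsSemialgebraic.biInter _ _ fun i _ =>
      (Literature.ModelTheory.ExponentialFields.isSemialgebraic_setOf_eval_pos _).inter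
        (Literature.ModelTheory.ExponentialFields.isSemialgebraic_setOf_eval_pos _)
  have hA' : IsSemialgebraic ℚ (openUnitCube d) := isSemialgebraic_openUnitCube
  -- guarded data
  let G₁ : (Fin (d + 1) → ℝ) → ℝ := fun z => if Fin.init z ∈ openUnitCube d then G z else 0
  let g₁ : (Fin (d + 1) → ℝ) → ℝ := fun z => if Fin.init z ∈ openUnitCube d then r.integrand z else 0
  let g₁' : (Fin d → ℝ) → ℝ := fun x => if x ∈ openUnitCube d then r'.integrand x else 0
  have hzero : ∀ {n : ℕ} (S : Set (Fin n → ℝ)), IsSemialgebraic ℚ S →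
      IsSemialgebraicFunOn ℚ S (fun _ => (0 : ℝ)) := fun S hS =>
    (isSemialgebraicFunOn_aeval hS (0 : MvPolynomial (Fin _) ℚ)).congr fun y _ => by simp
  have guard_sa : ∀ (S : Set (Fin (d + 1) → ℝ)) (f : (Fin (d + 1) → ℝ) → ℝ), IsSemialgebraic ℚ S →
      IsSemialgebraicFunOn ℚ S f →
      IsSemialgebraicFunOn ℚ S (fun z => if Fin.init z ∈ openUnitCube d then f z else 0) := by
    intro S f hS hf
    have h := IsSemialgebraicFunOn.union (F := fun z => if Fin.init z ∈ openUnitCube d then f z else 0)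
      (hf.mono inter_subset_left (hS.inter hA)) (hzero (S \ A) (hS.diff hA))
      (fun z hz => by simp only [if_pos (show Fin.init z ∈ openUnitCube d from hz.2)])
      (fun z hz => by simp only [if_neg (show Fin.init z ∉ openUnitCube d from hz.2)])
    rwa [inter_union_sdiff] at h
  have guard_sa' : ∀ (f : (Fin d → ℝ) → ℝ), IsSemialgebraicFunOn ℚ (KZ.cube d) f →
      IsSemialgebraicFunOn ℚ (KZ.cube d) (fun x => if x ∈ openUnitCube d then f x else 0) := by
    intro f hf
    have h := IsSemialgebraicFunOn.union (F := fun x => if x ∈ openUnitCube d then f x else 0)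
      (hf.mono inter_subset_left (KZ.isSemialgebraic_cube.inter hA')) (hzero _ (KZ.isSemialgebraic_cube.diff hA'))
      (fun z hz => by simp only [if_pos (show z ∈ openUnitCube d from hz.2)])
      (fun z hz => by simp only [if_neg (show z ∉ openUnitCube d from hz.2)])
    rwa [inter_union_sdiff] at h
  -- the guarded representations
  obtain ⟨r₁, hr₁, hr₁i⟩ : ∃ r₁ : KZ.IntegralRep (d + 1), r₁.domain = KZ.cube (d + 1) ∧ r₁.integrand = g₁ := by
    refine ⟨⟨KZ.cube (d + 1), g₁, KZ.isSemialgebraic_cube, ?_, ?_⟩, rfl, rfl⟩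
    · exact guard_sa _ _ KZ.isSemialgebraic_cube (hr ▸ r.isSemialgebraicFunOn_integrand)
    · refine (hr ▸ r.integrableOn).congr ?_
      filter_upwards [ae_mem_openUnitCube (d := d + 1)] with z hz
      have : Fin.init z ∈ openUnitCube d := fun i => hz (Fin.castSucc i)
      simp only [g₁, if_pos this]
  obtain ⟨r₁', hr₁', hr₁'i⟩ : ∃ r₁' : KZ.IntegralRep d, r₁'.domain = KZ.cube d ∧ r₁'.integrand = g₁' := by
    refine ⟨⟨KZ.cube d, g₁', KZ.isSemialgebraic_cube, ?_, ?_⟩, rfl, rfl⟩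
    · exact guard_sa' _ (hr' ▸ r'.isSemialgebraicFunOn_integrand)
    · refine (hr' ▸ r'.integrableOn).congr ?_
      filter_upwards [ae_mem_openUnitCube (d := d)] with z hz
      simp only [g₁', if_pos hz]
  -- `⟦r⟧ = ⟦r₁⟧`, `⟦r'⟧ = ⟦r₁'⟧`
  have e₁ : KZ.toPeriodAlgebra (KZ.toFormalPeriod (KZ.of r)) = KZ.toPeriodAlgebra (KZ.toFormalPeriod (KZ.of r₁)) :=
    cls_congr_open hr hr₁ fun z hz => by
      have : Fin.init z ∈ openUnitCube d := fun i => hz (Fin.castSucc i)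
      rw [hr₁i]; simp only [g₁, if_pos this]
  have e₂ : KZ.toPeriodAlgebra (KZ.toFormalPeriod (KZ.of r')) = KZ.toPeriodAlgebra (KZ.toFormalPeriod (KZ.of r₁')) :=
    cls_congr_open hr' hr₁' fun z hz => by rw [hr₁'i]; simp only [g₁', if_pos hz]
  rw [e₁, e₂]
  -- Newton–Leibniz for the guarded data, over the whole closed base cube
  refine CornerReps.cls_newtonLeibniz_cube r₁ r₁' G₁ hr₁ hr₁' (guard_sa _ _ KZ.isSemialgebraic_cube hG)
    ?_ ?_ ?_
  · intro x _
    by_cases hx : x ∈ openUnitCube d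
    · simp only [G₁, Fin.init_snoc, if_pos hx]; exact hcont x hx
    · simp only [G₁, Fin.init_snoc, if_neg hx]; exact continuousOn_const
  · intro x _ t ht
    rw [hr₁i]
    by_cases hx : x ∈ openUnitCube d
    · simp only [G₁, g₁, Fin.init_snoc, if_pos hx]; exact hderiv x hx t ht
    · simp only [G₁, g₁, Fin.init_snoc, if_neg hx]; exact hasDerivAt_const t 0
  · intro x _
    rw [hr₁'i]
    by_cases hx : x ∈ openUnitCube d
    · simp only [G₁, g₁', Fin.init_snoc, if_pos hx]; exact hbase x hx
    · simp only [G₁, g₁', Fin.init_snoc, if_neg hx, sub_zero]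


end CornerCubes

/-- **Hook `cornerCubes_congr_open`** (registered form of `CornerCubes.cls_congr_open`): two
representations on a closed unit cube whose integrands agree on the open cube have the same class
in `P_ℚ`. [cite: KontsevichZagier2001, §1.2 rule (1)] -/
theorem cornerCubes_congr_open : ∀ (d : ℕ) (r r' : KZ.IntegralRep d), r.domain = KZ.cube d → r'.domain = KZ.cube d → (∀ z ∈ openUnitCube d, r.integrand z = r'.integrand z) → KZ.toPeriodAlgebra (KZ.toFormalPeriod (KZ.of r)) = KZ.toPeriodAlgebra (KZ.toFormalPeriod (KZ.of r')) :=
  fun _ _ _ hr hr' h => CornerCubes.cls_congr_open hr hr' h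

end Summit.KontsevichZagierPeriods.FurushoPentagon.PentagonInKZ
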